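import Summits.Ventures.Crystal3D.Theorems.StickyWulffConstantCoaxialWallLawBarlowOneFccRow
import Summits.Ventures.Crystal3D.Theorems.StickyWulffConstantCoaxialWallLawBarlowOneFccPayerWindow
import HarnessLib

/-!
# The ONE-FCC F_layer cell in lane T's payer currency: raw sources ≤ s_F · Σ_PAY (12 − deg) + K·ρ (file (E), part 2, of the assembly plan)

HONEST FRAMING. Venture `Summits/Ventures/Crystal3D` (cell `crystal3d-full`); helper `--supports` the crux `CoaxialWallLaw`
(stmt-Ventures-19481, REGISTERED line `WallLedgerF`) in its role as owner of lane T's debt T-F2 / F_layer — TexShadow v8.4's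
`stub_fLayerOneFcc` (cf-p1 (civ)/(cx); HOME/wall-19481-p1/g15/ONEFCC-ASSEMBLY-PLAN-g15.md).  Inputs `KissingGap δ`,
`KissingClassification δ` and the row BY NAME; census-free; nothing about the crux is claimed; F-C1 not moved.

`oneFcc_rawSources_le_payers` (…BarlowOneFccRow, p698966) pays with the widened window `[−R₀−3, h+R₀+3]` and carries the two rim
annuli of the shifted census; here both are converted to lane T's currency (`bilayerWallAt_of_payerBound`, …BilayerWallBookkeeping:
`PAY = {y ∈ X : deg y ≠ 12, −R₀−2 ≤ y₂ ≤ h+R₀+2}`):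
* the extra-band payers are rim balls, `≤ 144ρ` each side (…BarlowOneFccPayerWindow), each worth `≤ 12`;
* the rim annuli hold `≤ 180ρ` (top) and `≤ 144ρ` (bottom) balls (`card_mul_le_of_separated_in_shell`), and `#RT ≤ 12`.
**`oneFcc_rawSources_le_payerSum`** — `Σ_r #sources_r ≤ sF·Σ_PAY (12 − deg) + (3456·sF + 855360)·ρ` for `sF ≥ 0`, `R₀ ≥ 5`, `ρ ≥ R₀ + 2`.
WHAT THIS IS NOT: not the flux lower bound of the LHS (file (B)), not the final `BilayerWallAt` (file (E3)); F-C1 not moved.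
-/

noncomputable section

namespace Summit.Ventures.Crystal3D.Theorems

open Summit.Ventures.Crystal3D Finset
open Literature.MathematicalPhysics.StatisticalMechanics (barlowPos barlowStacking IsHaggSeq basalMirror)
open Summit.Ventures.Crystal3D.Cruxes.TextureLiminf.TexShadow (E3 stacking)
open scoped InnerProductSpace

open scoped Classical in
/-- **The ONE-FCC cell in lane T's payer currency.**  See the module docstring. -/
theorem oneFcc_rawSources_le_payerSum (ver : WordVersion) {δ : ℝ} (hg : KissingGap δ) (hc : KissingClassification δ)
    {σ₁ σ₂ : ℤ → ℤ} (hσ₁ : IsHaggSeq σ₁) (L₁ L₂ : E3 ≃ₗᵢ[ℝ] E3) (s₁ s₂ : E3)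
    (Fr : E3 ≃ₗᵢ[ℝ] E3) {t : ℤ} (hFr : (t = 1 ∧ Fr = L₁) ∨ (t = -1 ∧ Fr = basalMirror.trans L₁))
    (Gf : E3 ≃ₗᵢ[ℝ] E3) {ε : ℤ} (hGf : (ε = 1 ∧ Gf = L₂) ∨ (ε = -1 ∧ Gf = basalMirror.trans L₂))
    (hσ₂ : ∀ n : ℤ, σ₂ n = ε)
    (hdozen : (Gf : E3 → E3) '' ↑fccSlots = (fun x => Fr (basalMirror x)) '' ↑fccSlots)
    {sF : ℝ} (hsF : 0 ≤ sF) (S₂ : PlateSystem) (hrow : LocalEndRowA ver sF ⟨Fr, inPlaneRoots Fr 1⟩ S₂)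
    (X P₁ P₂ : Finset E3) (R₀ h ρ : ℝ) (hR₀ : 5 ≤ R₀) (hρ : R₀ + 2 ≤ ρ)
    (hX : ∀ p ∈ X, ∀ q ∈ X, p ≠ q → 1 ≤ dist p q) (hP₁X : P₁ ⊆ X) (hP₂X : P₂ ⊆ X)
    (hcell : ∀ p ∈ X, -(2 * R₀) ≤ p 2 ∧ p 2 ≤ h + 2 * R₀ ∧ p 0 ^ 2 + p 1 ^ 2 ≤ ρ ^ 2)
    (hP₁ : ∀ p, p ∈ P₁ ↔ (p ∈ stacking L₁ s₁ σ₁ ∧ -(2 * R₀) ≤ p 2 ∧ p 2 ≤ -R₀ ∧ p 0 ^ 2 + p 1 ^ 2 ≤ ρ ^ 2))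
    (hP₂ : ∀ p, p ∈ P₂ ↔ (p ∈ stacking L₂ s₂ σ₂ ∧ h + R₀ ≤ p 2 ∧ p 2 ≤ h + 2 * R₀ ∧ p 0 ^ 2 + p 1 ^ 2 ≤ ρ ^ 2)) :
    ((∑ r ∈ inPlaneRoots Fr 1,
        ((P₁.filter fun p => -(R₀ + 1) - 1 - 1 ≤ p 2 ∧ p 2 ≤ -(R₀ + 1) - 1 ∧ p 0 ^ 2 + p 1 ^ 2 ≤ (ρ - 1 - 1) ^ 2).filter
          fun p => (∃ k i j : ℤ, p = L₁ (barlowPos 1 (Real.sqrt (2 / 3)) σ₁ k i j) + s₁ ∧ ¬ (σ₁ (k - 1) = -t ∧ σ₁ k = -t)) ∧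
            -(R₀ + 1) - 1 < (p + Fr r) 2 ∧ (p + Fr r) 2 < h + (R₀ + 1) + 1).card : ℕ) : ℝ) ≤
      sF * ∑ y ∈ X.filter (fun y => (X.filter fun q => dist y q = 1).card ≠ 12 ∧ -R₀ - 2 ≤ y 2 ∧ y 2 ≤ h + R₀ + 2),
          ((12 : ℝ) - ((X.filter fun q => dist y q = 1).card : ℝ)) +
        (3456 * sF + 855360) * ρ := by
  have hε : ε = 1 ∨ ε = -1 := by
    rcases hGf with ⟨h1, -⟩ | ⟨h1, -⟩
    · exact Or.inl h1
    · exact Or.inr h1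
  have hσ₂H : IsHaggSeq σ₂ := fun n => by rw [hσ₂ n]; exact hε
  have hrow' := oneFcc_rawSources_le_payers ver hg hc hσ₁ L₁ L₂ s₁ s₂ Fr hFr Gf hGf hσ₂ hdozen S₂ hrow X P₁ P₂ R₀ h ρ
    hR₀ hρ hX hP₁X hP₂X hP₁ hP₂
  -- notation
  set deg : E3 → ℕ := fun z => (X.filter fun q => dist z q = 1).card with hdeg
  set f : E3 → ℝ := fun z => (12 : ℝ) - (deg z : ℝ) with hf
  set PAYW := X.filter (fun z => deg z ≤ 11 ∧ -(R₀ + 1) - 2 ≤ z 2 ∧ z 2 ≤ h + (R₀ + 1) + 2) with hPAYW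
  set PAY := X.filter (fun y => deg y ≠ 12 ∧ -R₀ - 2 ≤ y 2 ∧ y 2 ≤ h + R₀ + 2) with hPAY
  set EX₁ := X.filter (fun z => deg z ≤ 11 ∧ -(R₀ + 1) - 2 ≤ z 2 ∧ z 2 < -R₀ - 2) with hEX₁
  set EX₂ := X.filter (fun z => deg z ≤ 11 ∧ h + R₀ + 2 < z 2 ∧ z 2 ≤ h + (R₀ + 1) + 2) with hEX₂
  have hdeg12 : ∀ z, deg z ≤ 12 := fun z => card_filter_dist_eq_one_le_twelve X hX z
  have hf12 : ∀ z, f z ≤ 12 := fun z => by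
    have : (0 : ℝ) ≤ (deg z : ℝ) := Nat.cast_nonneg _
    simp only [hf]; linarith
  have hfnn : ∀ z, deg z ≠ 12 → 0 ≤ f z := fun z hz => by
    have h12 : deg z ≤ 11 := by have := hdeg12 z; omega
    have : (deg z : ℝ) ≤ 11 := by exact_mod_cast h12
    simp only [hf]; linarith
  -- (1) the widened payer sum: middle part ⊆ PAY, the two extra bands are rim balls
  have hsplit := (sum_filter_add_sum_filter_not PAYW (fun z => -R₀ - 2 ≤ z 2 ∧ z 2 ≤ h + R₀ + 2) f).symm
  have hmid : ∑ z ∈ PAYW.filter (fun z => -R₀ - 2 ≤ z 2 ∧ z 2 ≤ h + R₀ + 2), f z ≤ ∑ y ∈ PAY, f y := by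
    refine sum_le_sum_of_subset_of_nonneg (fun z hz => ?_) (fun y hy _ => hfnn y (mem_filter.1 hy).2.1)
    obtain ⟨hzW, h1, h2⟩ := mem_filter.1 hz
    obtain ⟨hzX, hz11, -, -⟩ := mem_filter.1 hzW
    exact mem_filter.2 ⟨hzX, by omega, h1, h2⟩
  have hout : ∑ z ∈ PAYW.filter (fun z => ¬ (-R₀ - 2 ≤ z 2 ∧ z 2 ≤ h + R₀ + 2)), f z ≤ 12 * ((EX₁.card : ℝ) + EX₂.card) := by
    have hsub : PAYW.filter (fun z => ¬ (-R₀ - 2 ≤ z 2 ∧ z 2 ≤ h + R₀ + 2)) ⊆ EX₁ ∪ EX₂ := by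
      intro z hz
      obtain ⟨hzW, hnot⟩ := mem_filter.1 hz
      obtain ⟨hzX, hz11, h1, h2⟩ := mem_filter.1 hzW
      rw [mem_union]
      by_cases hlo : z 2 < -R₀ - 2
      · exact Or.inl (mem_filter.2 ⟨hzX, hz11, h1, hlo⟩)
      · push Not at hlo
        have hhi : h + R₀ + 2 < z 2 := by
          by_contra hle; push Not at hle; exact hnot ⟨hlo, hle⟩
        exact Or.inr (mem_filter.2 ⟨hzX, hz11, hhi, h2⟩)
    calc ∑ z ∈ PAYW.filter (fun z => ¬ (-R₀ - 2 ≤ z 2 ∧ z 2 ≤ h + R₀ + 2)), f z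
        ≤ ∑ z ∈ PAYW.filter (fun z => ¬ (-R₀ - 2 ≤ z 2 ∧ z 2 ≤ h + R₀ + 2)), (12 : ℝ) := sum_le_sum fun z _ => hf12 z
      _ = 12 * ((PAYW.filter (fun z => ¬ (-R₀ - 2 ≤ z 2 ∧ z 2 ≤ h + R₀ + 2))).card : ℝ) := by
          rw [sum_const, nsmul_eq_mul, mul_comm]
      _ ≤ 12 * ((EX₁.card : ℝ) + EX₂.card) := by
          have h1 := card_le_card hsub
          have h2 := card_union_le EX₁ EX₂
          have : ((PAYW.filter (fun z => ¬ (-R₀ - 2 ≤ z 2 ∧ z 2 ≤ h + R₀ + 2))).card : ℝ) ≤ (EX₁.card : ℝ) + EX₂.card := by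
            exact_mod_cast h1.trans h2
          linarith
  have hEX₁ : (EX₁.card : ℝ) ≤ 144 * ρ :=
    extraPayers_card_le₁ hσ₁ L₁ s₁ hX hP₁X hcell hP₁ (by linarith) (by linarith)
  have hEX₂ : (EX₂.card : ℝ) ≤ 144 * ρ :=
    extraPayers_card_le₂ hσ₂H L₂ s₂ hX hP₂X hcell hP₂ (by linarith) (by linarith)
  have hPAYW : ∑ z ∈ PAYW, f z ≤ ∑ y ∈ PAY, f y + 3456 * ρ := by
    rw [hsplit]; nlinarith [hmid, hout, hEX₁, hEX₂]
  -- (2) the rims of the shifted census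
  have hρ0 : (0 : ℝ) ≤ ρ := by linarith
  set RIMT := X.filter (fun s => h + (R₀ + 1) + 1 ≤ s 2 ∧ s 2 ≤ h + (R₀ + 1) + 1 + 1 ∧ (ρ - 1 - 2) ^ 2 < s 0 ^ 2 + s 1 ^ 2)
    with hRIMT
  set RIMB := X.filter (fun s => -(R₀ + 1) - 1 - 1 ≤ s 2 ∧ s 2 < -(R₀ + 1) - 1 ∧ (ρ - 1 - 1) ^ 2 < s 0 ^ 2 + s 1 ^ 2)
    with hRIMB
  have hrimT : (RIMT.card : ℝ) ≤ 180 * ρ := by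
    have hsep : ∀ p ∈ RIMT, ∀ q ∈ RIMT, p ≠ q → 1 ≤ dist p q :=
      fun p hp q hq hpq => hX p (mem_filter.1 hp).1 q (mem_filter.1 hq).1 hpq
    have hmem : ∀ p ∈ RIMT, h + (R₀ + 1) + 1 ≤ p 2 ∧ p 2 ≤ h + (R₀ + 1) + 1 + 1 ∧ (ρ - 1 - 2) ^ 2 < p 0 ^ 2 + p 1 ^ 2 ∧
        p 0 ^ 2 + p 1 ^ 2 ≤ ρ ^ 2 := by
      intro p hp
      obtain ⟨hpX, h1, h2, h3⟩ := mem_filter.1 hp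
      exact ⟨h1, h2, h3, (hcell p hpX).2.2⟩
    have key := card_mul_le_of_separated_in_shell RIMT hsep (h + (R₀ + 1) + 1) (h + (R₀ + 1) + 1 + 1) (ρ - 1 - 2) ρ
      (by linarith) (by linarith) (by linarith) hmem
    have e : (h + (R₀ + 1) + 1 + 1 - (h + (R₀ + 1) + 1) + 2) * (Real.pi * (ρ + 1) ^ 2 - Real.pi * (ρ - 1 - 2 - 1) ^ 2) =
        (Real.pi / 6) * (180 * ρ - 270) := by ring
    rw [e] at key
    have hπ : 0 < Real.pi / 6 := by positivity
    have := le_of_mul_le_mul_right (by linarith [key] : (RIMT.card : ℝ) * (Real.pi / 6) ≤ (180 * ρ - 270) * (Real.pi / 6)) hπ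
    linarith
  have hrimB : (RIMB.card : ℝ) ≤ 144 * ρ := by
    have hsep : ∀ p ∈ RIMB, ∀ q ∈ RIMB, p ≠ q → 1 ≤ dist p q :=
      fun p hp q hq hpq => hX p (mem_filter.1 hp).1 q (mem_filter.1 hq).1 hpq
    have hmem : ∀ p ∈ RIMB, -(R₀ + 1) - 1 - 1 ≤ p 2 ∧ p 2 ≤ -(R₀ + 1) - 1 ∧ (ρ - 1 - 1) ^ 2 < p 0 ^ 2 + p 1 ^ 2 ∧
        p 0 ^ 2 + p 1 ^ 2 ≤ ρ ^ 2 := by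
      intro p hp
      obtain ⟨hpX, h1, h2, h3⟩ := mem_filter.1 hp
      exact ⟨h1, h2.le, h3, (hcell p hpX).2.2⟩
    have key := card_mul_le_of_separated_in_shell RIMB hsep (-(R₀ + 1) - 1 - 1) (-(R₀ + 1) - 1) (ρ - 1 - 1) ρ
      (by linarith) (by linarith) (by linarith) hmem
    have e : (-(R₀ + 1) - 1 - (-(R₀ + 1) - 1 - 1) + 2) * (Real.pi * (ρ + 1) ^ 2 - Real.pi * (ρ - 1 - 1 - 1) ^ 2) =
        (Real.pi / 6) * (144 * ρ - 144) := by ring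
    rw [e] at key
    have hπ : 0 < Real.pi / 6 := by positivity
    have := le_of_mul_le_mul_right (by linarith [key] : (RIMB.card : ℝ) * (Real.pi / 6) ≤ (144 * ρ - 144) * (Real.pi / 6)) hπ
    linarith
  have hRTcard : ((inPlaneRoots Fr 1).card : ℝ) ≤ 12 := by
    have : (inPlaneRoots Fr 1).card ≤ 12 := (card_le_card (filter_subset _ _)).trans (by rw [card_fccSlots])
    exact_mod_cast this
  have hrims : ((inPlaneRoots Fr 1).card : ℝ) * (220 * (RIMT.card : ℝ) + 220 * (RIMB.card : ℝ)) ≤ 855360 * ρ := by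
    have h1 : 220 * (RIMT.card : ℝ) + 220 * (RIMB.card : ℝ) ≤ 71280 * ρ := by linarith
    have h0 : (0 : ℝ) ≤ 220 * (RIMT.card : ℝ) + 220 * (RIMB.card : ℝ) := by
      have ha : (0 : ℝ) ≤ (RIMT.card : ℝ) := Nat.cast_nonneg _
      have hb : (0 : ℝ) ≤ (RIMB.card : ℝ) := Nat.cast_nonneg _
      linarith
    nlinarith
  -- (3) assemble
  have hmono : sF * ∑ z ∈ PAYW, f z ≤ sF * (∑ y ∈ PAY, f y + 3456 * ρ) := mul_le_mul_of_nonneg_left hPAYW hsF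
  have e1 : sF * (∑ y ∈ PAY, f y + 3456 * ρ) = sF * ∑ y ∈ PAY, f y + 3456 * sF * ρ := by ring
  linarith [hrow', hmono, hrims, e1]

end Summit.Ventures.Crystal3D.Theorems

end
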